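import Summits.AtomisticToContinuum.HydrodynamicLimit.Theorems.AntiMazurCoboundariesKineticWindowGronwallDensityOnlyWindowRenyi
import Summits.AtomisticToContinuum.HydrodynamicLimit.Theorems.AntiMazurCoboundariesKineticWindowGronwallPlusNode
import Literature.Analysis.FluidPDE.CollisionalTransfer
import HarnessLib

/-!
# The FREE half of the energy-increment tightness: backward tilts of the `κ`-energy increment over kinetic windows
# (stub `stub_backwardTiltEnergyIncrementFree`, line `board-node-dock`, crux `KineticWindowGronwall`, stmt-AtomisticToContinuum-9282)

Crux `Summit.AtomisticToContinuum.HydrodynamicLimit.Theses.AntiMazurCoboundaries.KineticWindowGronwall`. Content (iii) of the local kinetic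
node (`stub_windowRenyiLocalGibbs` of skeleton v3) is the order-`p` Rényi quasi-invariance of local Gibbs laws over kinetic windows; for general
data it reduces to exponential tightness of the kinetic-window increments of `E_κ := energyObservable θ₀⁻¹ = Σᵢ ‖vᵢ‖²/(2θ₀(xᵢ))` — the velocity
exponent of the local Gibbs density — and of the tested momentum (`WindowRenyiOfIncrementTightness`). THIS FILE proves that ONE SIDE is free:
for drift-free continuous data (`u₀ ≡ 0`, `a, θ₀ > 0`) and every tilt `c ∈ [0, 1]`,
`∫ exp(−c (E_κ(Φ_s z) − E_κ(z))) dλ_N ≤ e^{ε(N+1)}` eventually in `N`, uniformly over flows and `0 ≤ s ≤ τ(N+1)^{-1/3}`.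
At `c = 1` the identity `ψ_N(z) e^{−ΔE_κ(z)} = [ψ_N · e^{L∘Φ_{−s} − L}](Φ_s z)` with the POSITION-ONLY `L = Σᵢ ℓ(xᵢ)`,
`ℓ = log a + log (2πθ₀)^{−3/2}`, and Liouville invariance of `Φ_s` give `∫ e^{−ΔE_κ} dλ_N = ∫ e^{L∘Φ_{−s} − L} dλ_N`, which is `≤ e^{ε(N+1)}` by the
path-length argument of `KineticWindowGronwallDensityOnlyWindowRenyi` (affine modulus of `ℓ`, `Σᵢ dist(xᵢ(−s), xᵢ(0)) ≤ s((N+1)/2 + E)`, Gaussian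
fibres); `0 < c < 1` follows by Hölder interpolation with `c = 0`. By log-convexity in the tilt every `c ∈ [−1, 0]` on `ΔE_κ` is thus free
(static: interpolation between `λ_N` and its transport), while the Rényi integral of order `p > 1` needs tilt `+(p − 1)`: the open core of (iii)
is the ONE-SIDED positive tilt (excess forward collisional heat conduction within a kinetic window). Folklore; no named fact is used.
-/

noncomputable section

namespace Summit.AtomisticToContinuum.HydrodynamicLimit.Theorems.KineticWindowGronwallBackwardTiltEnergyIncrementFree

open _root_.MeasureTheory _root_.Set _root_.Filter _root_.Topology
open scoped _root_.ENNReal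
open Literature.Analysis.FluidPDE Literature.MathematicalPhysics.KineticTheory
open Summit.AtomisticToContinuum.HydrodynamicLimit.Theorems.KineticWindowGronwallDensityOnlyWindowRenyi
  (exists_affine_modulus sum_euclidDist_flow_neg_le)

/-! ## §1 Statement (verbatim from the line's toolkit `Cruxes/KineticWindowGronwall/Lines/board_node_dock_toolkit.lean`) -/

/-- The hard-sphere flow of `N+1` spheres at reduced density `σ` on `𝕋³`. -/
abbrev TFlow (σ : ℝ) (N : ℕ) : Type :=
  HardSphereFlow (Torus.geometry (Fin 3)) (hsDiameter σ N) (N + 1)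

/-- **Helper statement `BackwardTiltEnergyIncrementFree`** (the FREE half of H_E, drift-free data): for continuous `a, θ₀ > 0`, `u₀ ≡ 0`,
a flow family and every tilt `c ∈ [0, 1]`, the NEGATIVE exponential moments `E_λ exp(−c·(E_κ(Φ_s z) − E_κ(z)))`, `E_κ = energyObservable θ₀⁻¹`
(`= Σᵢ ‖vᵢ‖²/(2θ₀(xᵢ))`, the velocity exponent of the local Gibbs density), are `≤ e^{ε(N+1)}` eventually in `N`, uniformly over
`0 ≤ s ≤ τ(N+1)^{-1/3}`: at `c = 1` Liouville invariance turns the integral into `E_λ exp(Σᵢ ℓ(xᵢ(−s)) − ℓ(xᵢ(0)))` with the POSITION-ONLY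
`ℓ = log a − (3/2)log(2πθ₀)` (path length, as in `DensityOnlyWindowRenyi`), and `0 < c < 1` follows by Hölder interpolation with `c = 0`.
So anti-thermodynamic O(N) decreases of `E_κ` within a kinetic window are exponentially unlikely for free; the open core of (iii) is the
ONE-SIDED positive tilt (excess forward collisional heat conduction). -/
def BackwardTiltEnergyIncrementFree : Prop :=
  ∀ (σ : ℝ) (a θ₀ : T3 → ℝ), Continuous a → Continuous θ₀ → (∀ x, 0 < a x) → (∀ x, 0 < θ₀ x) →
    ∀ (Φ : (N : ℕ) → TFlow σ N) (c : ℝ), 0 ≤ c → c ≤ 1 →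
    ∀ τ ε : ℝ, 0 < τ → 0 < ε → ∃ N₀ : ℕ, ∀ N : ℕ, N₀ ≤ N → ∀ s : ℝ, 0 ≤ s →
      s ≤ τ * ((N : ℝ) + 1) ^ (-(1 / 3 : ℝ)) →
      ∫⁻ z, ENNReal.ofReal (Real.exp (-(c *
          (energyObservable (fun x => (θ₀ x)⁻¹) ((Φ N).flow s z) - energyObservable (fun x => (θ₀ x)⁻¹) z))))
        ∂(localGibbsLaw σ a (fun _ => (0 : V3)) θ₀ N (Φ N)) ≤ ENNReal.ofReal (Real.exp (ε * ((N : ℝ) + 1)))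

/-! ## §2 The drift-free local Gibbs density: position part and velocity exponent -/

section Density

variable {σ : ℝ} {N : ℕ} {a θ₀ : T3 → ℝ}

/-- The Maxwellian prefactor `(2πθ₀(x))^{−d/2}` (with `d = finrank V3`). -/
def pref (θ₀ : T3 → ℝ) (x : T3) : ℝ :=
  1 * (2 * Real.pi * θ₀ x) ^ (-(Module.finrank ℝ V3 : ℝ) / 2)

/-- The prefactor is positive for `θ₀ > 0`. [folklore] -/
theorem pref_pos (hθ0 : ∀ x, 0 < θ₀ x) (x : T3) : 0 < pref θ₀ x := by
  unfold pref
  rw [one_mul]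
  exact Real.rpow_pos_of_pos (by have := hθ0 x; positivity) _

/-- The position-only log-weight `ℓ = log a + log (2πθ₀)^{−d/2}`. -/
def ell (a θ₀ : T3 → ℝ) (x : T3) : ℝ :=
  Real.log (a x) + Real.log (pref θ₀ x)

/-- `ℓ` is continuous for continuous `a, θ₀ > 0`. [folklore] -/
theorem continuous_ell (ha : Continuous a) (hθ : Continuous θ₀) (ha0 : ∀ x, 0 < a x) (hθ0 : ∀ x, 0 < θ₀ x) :
    Continuous (ell a θ₀) := by
  have hp : Continuous (pref θ₀) := by
    unfold pref
    refine continuous_const.mul (Continuous.rpow_const (by fun_prop) fun x => Or.inl ?_)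
    have := hθ0 x
    positivity
  exact (ha.log fun x => (ha0 x).ne').add (hp.log fun x => (pref_pos hθ0 x).ne')

/-- The drift-free local Maxwellian is the prefactor times `exp(−θ₀(x)⁻¹ ‖v‖²/2)`. [folklore] -/
theorem localMaxwellian_zero_eq (θ₀ : T3 → ℝ) (x : T3) (v : V3) :
    localMaxwellian 1 (θ₀ x) (0 : V3) v = pref θ₀ x * Real.exp (-((θ₀ x)⁻¹ * (‖v‖ ^ 2 / 2))) := by
  simp only [localMaxwellian, pref, sub_zero]
  congr 1
  congr 1
  rw [neg_div, div_eq_inv_mul, mul_comm (2 * θ₀ x)⁻¹, mul_inv]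
  ring

/-- **The canonical density of the drift-free local Gibbs profile ON THE HARD-SPHERE DOMAIN**:
`Z⁻¹ · exp(Σᵢ ℓ(xᵢ)) · exp(−E_κ(z))` with `E_κ = energyObservable θ₀⁻¹`. [folklore] -/
theorem canonicalDensity_eq_of_mem (ha0 : ∀ x, 0 < a x) (hθ0 : ∀ x, 0 < θ₀ x) {z : Config (N + 1) (Fin 3) T3}
    (hz : z ∈ hardSphereDomain (Torus.geometry (Fin 3)) (N + 1) (hsDiameter σ N)) :
    canonicalDensity (Torus.geometry (Fin 3)) (hsDiameter σ N) (N + 1) (localGibbsProfile a (fun _ => (0 : V3)) θ₀) z =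
      (canonicalPartition (Torus.geometry (Fin 3)) (hsDiameter σ N) (N + 1) (localGibbsProfile a (fun _ => (0 : V3)) θ₀))⁻¹ *
        (Real.exp (∑ i, ell a θ₀ (z i).1) * Real.exp (-energyObservable (fun x => (θ₀ x)⁻¹) z)) := by
  rw [canonicalDensity, Set.indicator_of_mem hz, tensorPow]
  congr 1
  have hterm : ∀ i, localGibbsProfile a (fun _ => (0 : V3)) θ₀ (z i) =
      Real.exp (ell a θ₀ (z i).1) * Real.exp (-((θ₀ (z i).1)⁻¹ * (‖(z i).2‖ ^ 2 / 2))) := by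
    intro i
    rw [localGibbsProfile, localMaxwellian_zero_eq, ← mul_assoc, ell, Real.exp_add, Real.exp_log (ha0 _),
      Real.exp_log (pref_pos hθ0 _)]
  simp_rw [hterm]
  rw [Finset.prod_mul_distrib, ← Real.exp_sum, ← Real.exp_sum, energyObservable, ← Finset.sum_neg_distrib]

/-- The canonical density of the drift-free local Gibbs profile is nonnegative. [folklore] -/
theorem canonicalDensity_nonneg (ha0 : ∀ x, 0 < a x) (hθ0 : ∀ x, 0 < θ₀ x) (z : Config (N + 1) (Fin 3) T3) :
    0 ≤ canonicalDensity (Torus.geometry (Fin 3)) (hsDiameter σ N) (N + 1) (localGibbsProfile a (fun _ => (0 : V3)) θ₀) z := by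
  have hp : 0 ≤ localGibbsProfile a (fun _ => (0 : V3)) θ₀ :=
    localGibbsProfile_nonneg (fun x => (ha0 x).le) fun x => (hθ0 x).le
  exact mul_nonneg (inv_nonneg.2 (Literature.MathematicalPhysics.KineticTheory.canonicalPartition_nonneg _ _ _ hp))
    (Set.indicator_nonneg (fun w _ => tensorPow_nonneg hp _ w) z)

end Density

/-! ## §3 Statics: total mass and the exponential moment of the kinetic energy (x-dependent temperature, no drift) -/

section Statics

variable {a θ₀ : T3 → ℝ}

/-- The total mass of a local Gibbs law is at most one (it is `Z⁻¹ · Z`; general continuous profiles). [folklore] -/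
theorem localGibbsLaw_univ_le_one (ha : Continuous a) (hθ : Continuous θ₀) (ha0 : ∀ x, 0 < a x) (hθ0 : ∀ x, 0 < θ₀ x)
    (σ : ℝ) (N : ℕ) (Φ : TFlow σ N) : localGibbsLaw σ a (fun _ => (0 : V3)) θ₀ N Φ univ ≤ 1 := by
  rw [localGibbsLaw_eq, localGibbsMeasure_univ ha hθ continuous_const (fun x => (ha0 x).le) hθ0 σ N]
  set Zp := posPartition a (hsDiameter σ N) (N + 1)
  have hZp : 0 ≤ Zp := posPartition_nonneg (fun x => (ha0 x).le) _ _
  rw [← ENNReal.ofReal_mul (inv_nonneg.2 hZp), ← ENNReal.ofReal_one]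
  refine ENNReal.ofReal_le_ofReal ?_
  rcases hZp.eq_or_lt with h | h
  · rw [← h]; simp
  · rw [inv_mul_cancel₀ h.ne']

/-- **Fibrewise bound, x-dependent temperature**: if a measurable velocity factor `g ≥ 0` has `∫ g dN(0, θ₀ x) ≤ K` at EVERY `x`, then
`∫ ∏ᵢ g(vᵢ) dλ_N ≤ K^{N+1}` (disintegration `lintegral_localGibbsMeasure`, total mass `≤ 1`). [folklore] -/
theorem lintegral_prod_vel_le_pow (ha : Continuous a) (hθ : Continuous θ₀) (ha0 : ∀ x, 0 < a x) (hθ0 : ∀ x, 0 < θ₀ x) (σ : ℝ)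
    (N : ℕ) (Φ : TFlow σ N) {g : V3 → ℝ≥0∞} (hg : Measurable g) {K : ℝ≥0∞}
    (hK : ∀ x : T3, ∫⁻ v, g v ∂gaussMeasure (0 : V3) (θ₀ x) ≤ K) (hKtop : K ≠ ∞) :
    ∫⁻ z, ∏ i, g (z i).2 ∂(localGibbsLaw σ a (fun _ => (0 : V3)) θ₀ N Φ) ≤ K ^ (N + 1) := by
  have hGm : Measurable fun z : Config (N + 1) (Fin 3) T3 => ∏ i, g (z i).2 :=
    Finset.measurable_prod _ fun i _ => hg.comp ((measurable_pi_apply i).snd)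
  have hmass := localGibbsLaw_univ_le_one ha hθ ha0 hθ0 σ N Φ
  rw [localGibbsLaw_eq] at hmass ⊢
  have hvel : ∀ x : Fin (N + 1) → T3,
      ∫⁻ v, (∏ i, g ((zipConfig (x, v) i).2)) ∂velMeasure (fun _ => (0 : V3)) θ₀ x ≤ K ^ (N + 1) := by
    intro x
    have h1 : ∫⁻ v, (∏ i, g ((zipConfig (x, v) i).2)) ∂velMeasure (fun _ => (0 : V3)) θ₀ x =
        ∏ i : Fin (N + 1), ∫⁻ w, g w ∂gaussMeasure (0 : V3) (θ₀ (x i)) := by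
      simp only [zipConfig_apply, velMeasure]
      exact lintegral_fintype_prod_eq_prod' (fun i => gaussMeasure (0 : V3) (θ₀ (x i))) (f := fun _ w => g w) fun _ => hg
    rw [h1]
    calc ∏ i : Fin (N + 1), ∫⁻ w, g w ∂gaussMeasure (0 : V3) (θ₀ (x i)) ≤ K ^ (Finset.univ : Finset (Fin (N + 1))).card :=
          Finset.prod_le_pow_card _ _ _ fun i _ => hK (x i)
      _ = K ^ (N + 1) := by rw [Finset.card_univ, Fintype.card_fin]
  set W : (Fin (N + 1) → T3) → ℝ≥0∞ := fun x => ENNReal.ofReal ((canonicalPartition (Torus.geometry (Fin 3))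
    (hsDiameter σ N) (N + 1) (localGibbsProfile a (fun _ => (0 : V3)) θ₀))⁻¹ * posWeight a (hsDiameter σ N) (N + 1) x)
  have hunit := lintegral_localGibbsMeasure (u₀ := fun _ => (0 : V3)) ha hθ continuous_const
    (fun x => (ha0 x).le) hθ0 σ N (G := fun _ => (1 : ℝ≥0∞)) measurable_const
  simp only [lintegral_const, measure_univ, mul_one, one_mul] at hunit
  rw [lintegral_localGibbsMeasure ha hθ continuous_const (fun x => (ha0 x).le) hθ0 σ N hGm]
  calc ∫⁻ x, W x * ∫⁻ v, (∏ i, g ((zipConfig (x, v) i).2)) ∂velMeasure (fun _ => (0 : V3)) θ₀ x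
      ≤ ∫⁻ x, W x * K ^ (N + 1) := lintegral_mono fun x => mul_le_mul' le_rfl (hvel x)
    _ = (∫⁻ x, W x) * K ^ (N + 1) := lintegral_mul_const' _ _ (ENNReal.pow_ne_top hKtop)
    _ ≤ 1 * K ^ (N + 1) := mul_le_mul' (by rw [← hunit]; exact hmass) le_rfl
    _ = K ^ (N + 1) := one_mul _

/-- **Exponential moment of the kinetic energy** (x-dependent temperature `θ₀ ≤ θM`, no drift): for `0 ≤ c ≤ 1/(4θM)`,
`∫ exp(c·E(z)) dλ_N ≤ exp((1 + 12θM)(c/2)(N+1))`. [folklore] -/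
theorem lintegral_exp_mul_configEnergy_le (ha : Continuous a) (hθ : Continuous θ₀) (ha0 : ∀ x, 0 < a x) (hθ0 : ∀ x, 0 < θ₀ x)
    {θM : ℝ} (hθM : ∀ x, θ₀ x ≤ θM) (σ : ℝ) (N : ℕ) (Φ : TFlow σ N) {c : ℝ} (hc0 : 0 ≤ c) (hc : c ≤ 1 / (4 * θM)) :
    ∫⁻ z, ENNReal.ofReal (Real.exp (c * configEnergy z)) ∂(localGibbsLaw σ a (fun _ => (0 : V3)) θ₀ N Φ) ≤
      ENNReal.ofReal (Real.exp ((1 + 12 * θM) * (c / 2) * ((N : ℝ) + 1))) := by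
  have hθMpos : 0 < θM := (hθ0 0).trans_le (hθM 0)
  set g : V3 → ℝ≥0∞ := fun v => ENNReal.ofReal (Real.exp (c / 2 * (1 + ‖v‖ ^ 2))) with hgdef
  have hgm : Measurable g := (Real.continuous_exp.comp (by fun_prop)).measurable.ennreal_ofReal
  set K : ℝ≥0∞ := ENNReal.ofReal (Real.exp ((1 + 2 * (0 : ℝ) ^ 2 + 12 * θM) * (c / 2))) with hKdef
  have hK : ∀ x : T3, ∫⁻ v, g v ∂gaussMeasure (0 : V3) (θ₀ x) ≤ K := fun x =>
    KineticWindowGronwallWindowEnergyMoment.lintegral_exp_mul_one_add_sq_norm_gaussMeasure_le (hθ0 x) (hθM x)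
      (by rw [norm_zero]) (by positivity) (by
        rw [div_le_div_iff₀ two_pos (by positivity)]
        have h4 : c * (4 * θM) ≤ 1 := (le_div_iff₀ (by positivity)).mp hc
        linarith)
  have hpt : ∀ z : Config (N + 1) (Fin 3) T3, ENNReal.ofReal (Real.exp (c * configEnergy z)) ≤ ∏ i, g (z i).2 := by
    intro z
    simp only [hgdef]
    rw [← ENNReal.ofReal_prod_of_nonneg fun i _ => (Real.exp_pos _).le, ← Real.exp_sum]
    refine ENNReal.ofReal_le_ofReal (Real.exp_le_exp.2 ?_)
    have h1 : c * configEnergy z = ∑ i, c / 2 * ‖(z i).2‖ ^ 2 := by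
      simp only [configEnergy, Finset.mul_sum]
      exact Finset.sum_congr rfl fun i _ => by ring
    rw [h1]
    exact Finset.sum_le_sum fun i _ => by nlinarith [sq_nonneg ‖(z i).2‖]
  calc ∫⁻ z, ENNReal.ofReal (Real.exp (c * configEnergy z)) ∂(localGibbsLaw σ a (fun _ => (0 : V3)) θ₀ N Φ)
      ≤ ∫⁻ z, ∏ i, g (z i).2 ∂(localGibbsLaw σ a (fun _ => (0 : V3)) θ₀ N Φ) := lintegral_mono hpt
    _ ≤ K ^ (N + 1) := lintegral_prod_vel_le_pow ha hθ ha0 hθ0 σ N Φ hgm hK ENNReal.ofReal_ne_top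
    _ = ENNReal.ofReal (Real.exp ((1 + 12 * θM) * (c / 2) * ((N : ℝ) + 1))) := by
        rw [hKdef, ← ENNReal.ofReal_pow (Real.exp_pos _).le, ← Real.exp_nat_mul]
        push_cast
        ring_nf

end Statics

/-- The weighted kinetic energy `energyObservable θ₀⁻¹` is continuous on phase space (`θ₀ > 0` continuous). [folklore] -/
theorem continuous_energyObservable {θ₀ : T3 → ℝ} (hθ : Continuous θ₀) (hθ0 : ∀ x, 0 < θ₀ x) (N : ℕ) :
    Continuous fun z : Config (N + 1) (Fin 3) T3 => energyObservable (fun x => (θ₀ x)⁻¹) z := by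
  unfold energyObservable
  refine continuous_finsetSum _ fun i _ => ?_
  have h1 : Continuous fun z : Config (N + 1) (Fin 3) T3 => (θ₀ (z i).1)⁻¹ :=
    ((hθ.comp (by fun_prop)).inv₀ fun z => (hθ0 _).ne')
  exact h1.mul (by fun_prop)

/-! ## §4 The Liouville identity at tilt `c = 1` -/

section Identity

variable {σ : ℝ} {N : ℕ} (Φ : TFlow σ N) {a θ₀ : T3 → ℝ}

/-- **The Liouville identity.** For continuous `a, θ₀ > 0` (no drift), every flow, every `s`:
`∫ exp(−(E_κ(Φ_s z) − E_κ(z))) dλ_N = ∫ exp(L(Φ_{−s} w) − L(w)) dλ_N(w)`, `L = Σᵢ ℓ(xᵢ)`: the weight `ψ_N e^{−ΔE_κ}` is the function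
`ψ_N · e^{L∘Φ_{−s} − L}` read at `Φ_s z` (the velocity exponent of `ψ_N` IS `E_κ`), and `Φ_s` preserves the Liouville measure. [folklore] -/
theorem lintegral_exp_neg_increment_eq (ha : Continuous a) (hθ : Continuous θ₀) (ha0 : ∀ x, 0 < a x) (hθ0 : ∀ x, 0 < θ₀ x) (s : ℝ) :
    ∫⁻ z, ENNReal.ofReal (Real.exp (-(energyObservable (fun x => (θ₀ x)⁻¹) (Φ.flow s z) -
        energyObservable (fun x => (θ₀ x)⁻¹) z))) ∂(localGibbsLaw σ a (fun _ => (0 : V3)) θ₀ N Φ) =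
      ∫⁻ w, ENNReal.ofReal (Real.exp (∑ i, ell a θ₀ (Φ.flow (-s) w i).1 - ∑ i, ell a θ₀ (w i).1))
        ∂(localGibbsLaw σ a (fun _ => (0 : V3)) θ₀ N Φ) := by
  -- notation
  set prof := localGibbsProfile a (fun _ => (0 : V3)) θ₀ with hprof
  set cd : Config (N + 1) (Fin 3) T3 → ℝ := canonicalDensity (Torus.geometry (Fin 3)) (hsDiameter σ N) (N + 1) prof with hcd
  set Z : ℝ := canonicalPartition (Torus.geometry (Fin 3)) (hsDiameter σ N) (N + 1) prof with hZ
  set Eκ : Config (N + 1) (Fin 3) T3 → ℝ := energyObservable (fun x => (θ₀ x)⁻¹) with hEκ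
  set L : Config (N + 1) (Fin 3) T3 → ℝ := fun z => ∑ i, ell a θ₀ (z i).1 with hL
  set Liou : Measure (Config (N + 1) (Fin 3) T3) := liouville (Torus.geometry (Fin 3)) (N + 1) (hsDiameter σ N) with hLiou
  have hlaw : localGibbsLaw σ a (fun _ => (0 : V3)) θ₀ N Φ = Liou.withDensity fun z => ENNReal.ofReal (cd z) := rfl
  -- measurability
  have hcdm : Measurable cd := measurable_canonicalDensity _ _ (measurable_localGibbsProfile ha hθ continuous_const)
  have hψm : Measurable fun z => ENNReal.ofReal (cd z) := hcdm.ennreal_ofReal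
  have hEc : Continuous Eκ := continuous_energyObservable hθ hθ0 N
  have hLc : Continuous L := continuous_finsetSum _ fun i _ => (continuous_ell ha hθ ha0 hθ0).comp (by fun_prop)
  have hFm : Measurable fun z => ENNReal.ofReal (Real.exp (-(Eκ (Φ.flow s z) - Eκ z))) :=
    (Real.measurable_exp.comp ((hEc.measurable.comp (Φ.measurable_flow s)).sub hEc.measurable).neg).ennreal_ofReal
  have hHm : Measurable fun w => ENNReal.ofReal (Real.exp (L (Φ.flow (-s) w) - L w)) :=
    (Real.measurable_exp.comp ((hLc.measurable.comp (Φ.measurable_flow (-s))).sub hLc.measurable)).ennreal_ofReal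
  set G : Config (N + 1) (Fin 3) T3 → ℝ≥0∞ := fun w => ENNReal.ofReal (cd w) * ENNReal.ofReal (Real.exp (L (Φ.flow (-s) w) - L w))
    with hG
  have hGm : Measurable G := hψm.mul hHm
  -- the pointwise identity on good orbits
  have hpt : ∀ z ∈ Φ.good, ENNReal.ofReal (cd z) * ENNReal.ofReal (Real.exp (-(Eκ (Φ.flow s z) - Eκ z))) = G (Φ.flow s z) := by
    intro z hz
    have hzD := Φ.good_subset hz
    have hwD := Φ.good_subset (Φ.mapsTo_good s hz)
    have hnn : ∀ y, 0 ≤ cd y := fun y => by rw [hcd]; exact canonicalDensity_nonneg ha0 hθ0 y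
    simp only [hG]
    rw [Φ.flow_neg_flow s hz, ← ENNReal.ofReal_mul (hnn z), ← ENNReal.ofReal_mul (hnn _)]
    congr 1
    rw [hcd, canonicalDensity_eq_of_mem ha0 hθ0 hzD, canonicalDensity_eq_of_mem ha0 hθ0 hwD]
    simp only [hL, hEκ, mul_assoc, ← Real.exp_add]
    congr 2
    ring
  -- the computation
  calc ∫⁻ z, ENNReal.ofReal (Real.exp (-(Eκ (Φ.flow s z) - Eκ z))) ∂(localGibbsLaw σ a (fun _ => (0 : V3)) θ₀ N Φ)
      = ∫⁻ z, ENNReal.ofReal (cd z) * ENNReal.ofReal (Real.exp (-(Eκ (Φ.flow s z) - Eκ z))) ∂Liou := by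
        rw [hlaw, lintegral_withDensity_eq_lintegral_mul _ hψm hFm]
        rfl
    _ = ∫⁻ z, G (Φ.flow s z) ∂Liou := by
        refine lintegral_congr_ae ?_
        filter_upwards [Φ.ae_mem_good] with z hz
        exact hpt z hz
    _ = ∫⁻ w, G w ∂Liou := (Φ.measurePreserving s).lintegral_comp hGm
    _ = ∫⁻ w, ENNReal.ofReal (Real.exp (L (Φ.flow (-s) w) - L w)) ∂(localGibbsLaw σ a (fun _ => (0 : V3)) θ₀ N Φ) := by
        rw [hlaw, lintegral_withDensity_eq_lintegral_mul _ hψm hHm]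
        rfl

end Identity

/-! ## §5 The registered stub -/

/-- **The bound at tilt `c = 1`**: `∫ exp(−ΔE_κ) dλ_N ≤ e^{ε(N+1)}` eventually, uniformly over flows and `|s| ≤ τ(N+1)^{-1/3}` (Liouville
identity, affine modulus of `ℓ`, path length, Gaussian energy moment). [folklore] -/
theorem lintegral_exp_neg_increment_le {a θ₀ : T3 → ℝ} (ha : Continuous a) (hθ : Continuous θ₀) (ha0 : ∀ x, 0 < a x)
    (hθ0 : ∀ x, 0 < θ₀ x) (σ τ ε : ℝ) (hε : 0 < ε) :
    ∃ N₀ : ℕ, ∀ N : ℕ, N₀ ≤ N → ∀ (Φ : TFlow σ N) (s : ℝ), |s| ≤ τ * ((N : ℝ) + 1) ^ (-(1 / 3 : ℝ)) →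
      ∫⁻ z, ENNReal.ofReal (Real.exp (-(energyObservable (fun x => (θ₀ x)⁻¹) (Φ.flow s z) -
          energyObservable (fun x => (θ₀ x)⁻¹) z))) ∂(localGibbsLaw σ a (fun _ => (0 : V3)) θ₀ N Φ) ≤
        ENNReal.ofReal (Real.exp (ε * ((N : ℝ) + 1))) := by
  obtain ⟨-, θM, -, -, hθM⟩ := KineticWindowGronwallPlusNode.exists_bounds_T3 hθ
  have hθMpos : 0 < θM := (hθ0 0).trans_le (hθM 0)
  obtain ⟨K, hK0, hK⟩ := exists_affine_modulus (continuous_ell ha hθ ha0 hθ0) (δ := ε / 2) (by positivity)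
  set C : ℝ := 1 + 12 * θM with hC
  set h₀ : ℝ := min (1 / (4 * θM * (K + 1))) (ε / ((K + 1) * (1 + C))) with hh₀
  have hh₀pos : 0 < h₀ := lt_min (by positivity) (by positivity)
  have hwin : Tendsto (fun N : ℕ => τ * ((N : ℝ) + 1) ^ (-(1 / 3 : ℝ))) atTop (𝓝 0) := by
    simpa using ((tendsto_rpow_neg_atTop (by norm_num : (0 : ℝ) < 1 / 3)).comp
      (tendsto_atTop_add_const_right _ 1 tendsto_natCast_atTop_atTop)).const_mul τ
  obtain ⟨N₀, hN₀⟩ := eventually_atTop.1 (hwin.eventually (Iic_mem_nhds hh₀pos))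
  refine ⟨N₀, fun N hN Φ s hs => ?_⟩
  have hsN : |s| ≤ h₀ := hs.trans (hN₀ N hN)
  have hs0 : 0 ≤ |s| := abs_nonneg s
  set c : ℝ := K * |s| with hc
  have hc0 : 0 ≤ c := by positivity
  have hcle : c ≤ (K + 1) * |s| := by rw [hc]; exact mul_le_mul_of_nonneg_right (by linarith) hs0
  have hc1 : c ≤ 1 / (4 * θM) := by
    calc c ≤ (K + 1) * |s| := hcle
      _ ≤ (K + 1) * (1 / (4 * θM * (K + 1))) := mul_le_mul_of_nonneg_left (hsN.trans (min_le_left _ _)) (by positivity)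
      _ = 1 / (4 * θM) := by field_simp
  have hC0 : 0 < C := by positivity
  have hc2 : c * (1 + C) ≤ ε := by
    calc c * (1 + C) ≤ (K + 1) * |s| * (1 + C) := mul_le_mul_of_nonneg_right hcle (by positivity)
      _ ≤ (K + 1) * (ε / ((K + 1) * (1 + C))) * (1 + C) :=
          mul_le_mul_of_nonneg_right (mul_le_mul_of_nonneg_left (hsN.trans (min_le_right _ _)) (by positivity)) (by positivity)
      _ = ε := by field_simp
  set P := localGibbsLaw σ a (fun _ => (0 : V3)) θ₀ N Φ with hP
  set A : ℝ := ((N : ℝ) + 1) * (ε / 2) + K * (|s| * (((N : ℝ) + 1) / 2)) with hA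
  rw [lintegral_exp_neg_increment_eq Φ ha hθ ha0 hθ0 s]
  have hpt : ∀ᵐ w ∂P, ENNReal.ofReal (Real.exp (∑ i, ell a θ₀ (Φ.flow (-s) w i).1 - ∑ i, ell a θ₀ (w i).1)) ≤
      ENNReal.ofReal (Real.exp A) * ENNReal.ofReal (Real.exp (c * configEnergy w)) := by
    filter_upwards [KineticWindowGronwallQuadraticMoment.ae_mem_good_localGibbsLaw σ a (fun _ => (0 : V3)) θ₀ N Φ] with w hw
    rw [← ENNReal.ofReal_mul (Real.exp_pos _).le, ← Real.exp_add]
    refine ENNReal.ofReal_le_ofReal (Real.exp_le_exp.2 ?_)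
    rw [← Finset.sum_sub_distrib]
    calc ∑ i, (ell a θ₀ (Φ.flow (-s) w i).1 - ell a θ₀ (w i).1)
        ≤ ∑ i, (ε / 2 + K * Torus.euclidDist ((Φ.flow (-s) w i).1) ((w i).1)) :=
          Finset.sum_le_sum fun i _ => (le_abs_self _).trans (hK _ _)
      _ = ((N : ℝ) + 1) * (ε / 2) + K * ∑ i, Torus.euclidDist ((Φ.flow (-s) w i).1) ((w i).1) := by
          rw [Finset.sum_add_distrib, Finset.sum_const, Finset.card_univ, Fintype.card_fin, nsmul_eq_mul, ← Finset.mul_sum]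
          push_cast; ring
      _ ≤ ((N : ℝ) + 1) * (ε / 2) + K * (|s| * (((N : ℝ) + 1) / 2 + configEnergy w)) := by
          gcongr; exact sum_euclidDist_flow_neg_le Φ hw s
      _ = A + c * configEnergy w := by rw [hA, hc]; ring
  calc ∫⁻ w, ENNReal.ofReal (Real.exp (∑ i, ell a θ₀ (Φ.flow (-s) w i).1 - ∑ i, ell a θ₀ (w i).1)) ∂P
      ≤ ∫⁻ w, ENNReal.ofReal (Real.exp A) * ENNReal.ofReal (Real.exp (c * configEnergy w)) ∂P := lintegral_mono_ae hpt
    _ = ENNReal.ofReal (Real.exp A) * ∫⁻ w, ENNReal.ofReal (Real.exp (c * configEnergy w)) ∂P :=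
        lintegral_const_mul' _ _ ENNReal.ofReal_ne_top
    _ ≤ ENNReal.ofReal (Real.exp A) * ENNReal.ofReal (Real.exp ((1 + 12 * θM) * (c / 2) * ((N : ℝ) + 1))) :=
        mul_le_mul' le_rfl (lintegral_exp_mul_configEnergy_le ha hθ ha0 hθ0 hθM σ N Φ hc0 hc1)
    _ = ENNReal.ofReal (Real.exp (((N : ℝ) + 1) * (ε / 2 + c / 2 + C * (c / 2)))) := by
        rw [← ENNReal.ofReal_mul (Real.exp_pos _).le, ← Real.exp_add, hC, hc, hA]
        congr 2
        field_simp
    _ ≤ ENNReal.ofReal (Real.exp (ε * ((N : ℝ) + 1))) := by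
        refine ENNReal.ofReal_le_ofReal (Real.exp_le_exp.2 ?_)
        have hN1 : (0 : ℝ) ≤ (N : ℝ) + 1 := by positivity
        have key : ε / 2 + c / 2 + C * (c / 2) ≤ ε := by nlinarith
        nlinarith

/-- **`stub_backwardTiltEnergyIncrementFree`: the registered statement holds** — the bound at `c = 1` and Hölder interpolation with
`c = 0` (`∫ f^c · 1^{1−c} ≤ (∫ f)^c (∫ 1)^{1−c}`, total mass `≤ 1`). [folklore] -/
theorem stub_backwardTiltEnergyIncrementFree : BackwardTiltEnergyIncrementFree := by
  intro σ a θ₀ ha hθ ha0 hθ0 Φ c hc0 hc1 τ ε _hτ hε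
  obtain ⟨N₀, hN₀⟩ := lintegral_exp_neg_increment_le ha hθ ha0 hθ0 σ τ ε hε
  refine ⟨N₀, fun N hN s hs0 hs => ?_⟩
  have h1 := hN₀ N hN (Φ N) s (by rwa [abs_of_nonneg hs0])
  set P := localGibbsLaw σ a (fun _ => (0 : V3)) θ₀ N (Φ N) with hP
  set D : Config (N + 1) (Fin 3) T3 → ℝ := fun z => energyObservable (fun x => (θ₀ x)⁻¹) ((Φ N).flow s z) -
    energyObservable (fun x => (θ₀ x)⁻¹) z with hD
  set f : Config (N + 1) (Fin 3) T3 → ℝ≥0∞ := fun z => ENNReal.ofReal (Real.exp (-D z)) with hf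
  have hEc : Continuous fun z : Config (N + 1) (Fin 3) T3 => energyObservable (fun x => (θ₀ x)⁻¹) z :=
    continuous_energyObservable hθ hθ0 N
  have hfm : AEMeasurable f P :=
    (Real.measurable_exp.comp ((hEc.measurable.comp ((Φ N).measurable_flow s)).sub hEc.measurable).neg).ennreal_ofReal.aemeasurable
  have hmass : P univ ≤ 1 := localGibbsLaw_univ_le_one ha hθ ha0 hθ0 σ N (Φ N)
  -- the integrand is `f^c · 1^{1−c}`
  have hpt : ∀ z, ENNReal.ofReal (Real.exp (-(c * D z))) = f z ^ c * (1 : ℝ≥0∞) ^ (1 - c) := by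
    intro z
    rw [ENNReal.one_rpow, mul_one, hf, ENNReal.ofReal_rpow_of_nonneg (Real.exp_pos _).le hc0, ← Real.exp_mul]
    congr 2
    ring
  calc ∫⁻ z, ENNReal.ofReal (Real.exp (-(c * D z))) ∂P
      = ∫⁻ z, f z ^ c * (fun _ => (1 : ℝ≥0∞)) z ^ (1 - c) ∂P := lintegral_congr hpt
    _ ≤ (∫⁻ z, f z ∂P) ^ c * (∫⁻ z, (fun _ => (1 : ℝ≥0∞)) z ∂P) ^ (1 - c) :=
        ENNReal.lintegral_mul_norm_pow_le hfm aemeasurable_const hc0 (by linarith) (by ring)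
    _ ≤ (ENNReal.ofReal (Real.exp (ε * ((N : ℝ) + 1)))) ^ c * 1 := by
        refine mul_le_mul' (ENNReal.rpow_le_rpow h1 hc0) ?_
        rw [lintegral_const, one_mul]
        exact ENNReal.rpow_le_one hmass (by linarith)
    _ ≤ ENNReal.ofReal (Real.exp (ε * ((N : ℝ) + 1))) := by
        rw [mul_one, ENNReal.ofReal_rpow_of_nonneg (Real.exp_pos _).le hc0, ← Real.exp_mul]
        refine ENNReal.ofReal_le_ofReal (Real.exp_le_exp.2 ?_)
        have : 0 ≤ ε * ((N : ℝ) + 1) := by positivity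
        nlinarith

end Summit.AtomisticToContinuum.HydrodynamicLimit.Theorems.KineticWindowGronwallBackwardTiltEnergyIncrementFree

end
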